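import Summits.BirchSwinnertonDyer.BirchSwinnertonDyer.Theorems.SmallImageMuTransferMuTransferX9StepFourFinal
import Summits.BirchSwinnertonDyer.BirchSwinnertonDyer.Theorems.SmallImageMuTransferMuTransferX9LocalTwistOperator
import Literature.NumberTheory.EllipticCurves.IwasawaTwistModPkTower
import Literature.NumberTheory.EllipticCurves.IwasawaTwistModPkDual
import HarnessLib

set_option autoImplicit false

-- the summit and its single problem are both named `BirchSwinnertonDyer` (registry layout D-0017)
set_option linter.dupNamespace false

/-!
# Crux `KatoDivisibilityX9` (stmt-BirchSwinnertonDyer-20547), line `graded_euler_loss`, stub `stub_reciprocityPkAX9`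
# (hG34ᵍ), item (M3) of `hKolyRecPk`, file 1: STEP 4 (Poitou–Tate side) AT LEVEL `p^k` — every member of the
# coefficient family `inv_q(T_q^j (loc_q c) ∪ loc_q (T^ε Ψ))` vanishes for the level-`p^k` twists, and the G3/G4
# meeting point `convCoeff_eq_zero_of_qTermIdentityPk` (the `q`-term identity entering as ONE hypothesis)

Seat `bsd-line-k6-p4` (prover-bsd-line-k6-p4-g5-0, wave-2 stub worker B).  THEOREMS ONLY (no definition, no named
fact, no `sorry`); generic (number field `K`, `p^k`-torsion discrete modules); `--supports stmt-BirchSwinnertonDyer-20547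
--as helper`.  Level-`p^k` twins of x10's `…X9StepFourReciprocityTwist` §1–§3, `…X9StepFourReciprocitySets` §2–§3 and
`…X9StepFourFinal` (`twistModP ↦ twistModPk`, `twistContPairing ↦` T6d `twistContPairingPk`, `twistDualMap ↦
twistDualMapPk`, `shiftH1 ↦ shiftH1Pk`, `μ_p ↦ μ_{p^k}`, `LocalInvariants K p ↦ LocalInvariants K (p^k)`).  x10's
GENERIC §1 of `…ReciprocitySets` (`localTerm_pairingDual_eq_zero_of_unramified_outside_set`, any odd `n`) and
`…Packaging` (`convCoeff_eq_zero_of_family_eq_zero`, any commutative ring) are reused as they are.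

* §1 `pow_nsmul_twistPk_eq_zero`, `toLocal_twistModPk_apply_of_mem_absInertia`, `isUnramifiedAt_twistModPk`,
  `toLocal_tateDual_twistModPk_apply_of_mem_absInertia`, `iterate_shiftH1Pk_localization_mem_unramifiedSubgroup`,
  `localization_iterate_shiftH1Pk`, `localization_cupProduct_twistContPairingPk`.
* §2 `localTerm_twistDualMapPk_eq_zero_of_unramified_outside_set`, `localTerm_iterate_shiftH1Pk_eq_zero_of_stub_hypotheses`,
  **`inv_cupProduct_restrict_iterate_localShift_eq_zero_of_stub_hypothesesPk`** (Poitou–Tate: every LHS vanishes).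
* §3 **`convCoeff_eq_zero_of_qTermIdentityPk`** — STEP 4 + the level-`p^k` `q`-term identity `hQ` ⟹
  `C_i(c(res τ_q), Ψc(res Fr_q)) = 0` for all `i + ε < J`.

References: B. Mazur, K. Rubin, Mem. AMS 799 (2004) Prop. 1.3.2, §4.4, §5.3 [MazurRubin2004]; J. S. Milne, *Arithmetic
Duality Theorems* (2006) I Thm. 2.6, Thm. 4.10(b) [MilneADT2006]; L. Washington, GTM 83, Prop. 13.2 [Washington1997].
-/

noncomputable section

open scoped ContRepresentation
open Function NumberField IsDedekindDomain Field Finset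
open scoped NumberField
open Literature.NumberTheory.GaloisRepresentations
open Literature.NumberTheory.GaloisRepresentations.DiscreteGaloisModule (mu MuCarrier pairing TateDual
  tateDual pairingDualIntertwining)
open Literature.NumberTheory.GaloisCohomology
open Literature.NumberTheory.EllipticCurves
open Literature.NumberTheory.EllipticCurves.ZpExtension
open Summit.BirchSwinnertonDyer.Rank1Residual.GaloisImage
open Summit.BirchSwinnertonDyer.BirchSwinnertonDyer.Rank1Residual
open Summit.BirchSwinnertonDyer.BirchSwinnertonDyer.Rank1Residual.StepFour

universe u

namespace Summit.BirchSwinnertonDyer.BirchSwinnertonDyer.Theorems.OneSidedTwistSqueezeX9KatoDivisibilityX9KolyvaginReciprocityPkStepFour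

variable {K : Type u} [Field K] [NumberField K] {p : ℕ} [Fact p.Prime] (κ : ZpExtension K p) {k : ℕ}
variable {M M' : Type u} [AddCommGroup M] [TopologicalSpace M] [DiscreteTopology M] [Finite M]
  [AddCommGroup M'] [TopologicalSpace M'] [DiscreteTopology M']
variable (ρ : DiscreteGaloisModule K M) (ρ' : DiscreteGaloisModule K M')
  (hM : ∀ x : M, p ^ k • x = 0) (hM' : ∀ x : M', p ^ k • x = 0) (J : ℕ)

/-! ### §1 Inertia and torsion bookkeeping for the level-`p^k` twists -/

omit [Fact p.Prime] [TopologicalSpace M] [DiscreteTopology M] [Finite M] [NumberField K] in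
include hM in
/-- `p^k · 𝒯_J^{(k)} = 0` (coordinatewise). [cite: Washington1997, §13.1–§13.2] -/
theorem pow_nsmul_twistPk_eq_zero (z : Fin J → M) : p ^ k • z = 0 := by
  funext i
  exact hM (z i)

omit [Finite M] in
/-- **The local inertia group at `v ∤ p` acts trivially on `𝒯_J^{(k)}`** when `ρ` is unramified at `v` (`κ` kills
inertia away from `p`, Washington Prop. 13.2; the twist exponent is `0`). [cite: Washington1997, Prop. 13.2] -/
theorem toLocal_twistModPk_apply_of_mem_absInertia (v : HeightOneSpectrum (𝓞 K))
    (hur : GaloisRep.IsUnramifiedAt v ρ) (hvp : ((p : ℕ) : 𝓞 K) ∉ v.asIdeal)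
    {t : absoluteGaloisGroup (v.adicCompletion K)} (ht : t ∈ absInertia (v.adicCompletion K))
    (z : Fin J → M) : GaloisRep.toLocal v (κ.twistModPk ρ hM J) t z = z := by
  change κ.twistModPk ρ hM J (absGaloisRestrict K (v.adicCompletion K) t) z = z
  rw [twistModPk_apply, LocalSplitPrime.twistExponent_eq_zero_of_apply_eq_one κ (J + k)
    (LocalSplitPrime.apply_absGaloisRestrict_eq_one_of_mem_absInertia κ v hvp ht), unipotentPow_zero,
    Module.End.one_apply]
  funext i
  change GaloisRep.toLocal v ρ t (z i) = z i
  rw [(GaloisRep.isUnramifiedAt_iff_toLocal_holds v ρ).1 hur t ht]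
  rfl

omit [Finite M] in
/-- **`𝒯_J^{(k)}(ρ, κ)` is unramified at a finite `v ∤ p` where `ρ` is.** [cite: Washington1997, Prop. 13.2] -/
theorem isUnramifiedAt_twistModPk (v : HeightOneSpectrum (𝓞 K)) (hur : GaloisRep.IsUnramifiedAt v ρ)
    (hvp : ((p : ℕ) : 𝓞 K) ∉ v.asIdeal) : GaloisRep.IsUnramifiedAt v (κ.twistModPk ρ hM J) := by
  refine (GaloisRep.isUnramifiedAt_iff_toLocal_holds v (κ.twistModPk ρ hM J)).2 fun t ht => ?_
  refine LinearMap.ext fun z => ?_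
  rw [Module.End.one_apply]
  exact toLocal_twistModPk_apply_of_mem_absInertia κ ρ hM J v hur hvp ht z

omit [Fact p.Prime] [NumberField K] in
/-- `p^k ∉ v` for a prime `v ∤ p` (`k ≥ 0`). [folklore] -/
theorem pow_natCast_not_mem {v : HeightOneSpectrum (𝓞 K)} (hvp : ((p : ℕ) : 𝓞 K) ∉ v.asIdeal) :
    ((p ^ k : ℕ) : 𝓞 K) ∉ v.asIdeal := by
  rw [Nat.cast_pow]
  exact fun h => hvp (v.isPrime.mem_of_pow_mem k h)

/-- Inertia at a finite `v ∤ p` where `ρ` is unramified fixes the Tate dual `𝒯_J^{(k)}(ρ, κ)^D = Hom(𝒯, μ_{p^k})`.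
[cite: MilneADT2006, Ch. I, Thm. 2.6] -/
theorem toLocal_tateDual_twistModPk_apply_of_mem_absInertia (v : HeightOneSpectrum (𝓞 K))
    (hur : GaloisRep.IsUnramifiedAt v ρ) (hvp : ((p : ℕ) : 𝓞 K) ∉ v.asIdeal)
    {t : absoluteGaloisGroup (v.adicCompletion K)} (ht : t ∈ absInertia (v.adicCompletion K))
    (f : TateDual K (Fin J → M) (p ^ k)) : GaloisRep.toLocal v ((κ.twistModPk ρ hM J).tateDual (p ^ k)) t f = f :=
  UnramifiedCup.toLocal_tateDual_apply_of_mem_absInertia_of_not_mem (κ.twistModPk ρ hM J) (p ^ k) v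
    (pow_natCast_not_mem hvp) (isUnramifiedAt_twistModPk κ ρ hM J v hur hvp) ht f

omit [Finite M] [NumberField K] in
/-- **Iterates of the shift keep unramified localisations** (`shiftH1Pk = H¹(twistModPkShift)`).
[cite: SerreGaloisCohomology1997, I §2.2] -/
theorem iterate_shiftH1Pk_localization_mem_unramifiedSubgroup [NumberField K] (v : HeightOneSpectrum (𝓞 K))
    {x : galoisCohomology (κ.twistModPk ρ hM J) 1}
    (hx : galoisCohomology.localization (κ.twistModPk ρ hM J) (Sum.inr v) 1 x ∈
      DiscreteGaloisModule.unramifiedSubgroup (GaloisRep.toLocal v (κ.twistModPk ρ hM J)) 1) (a : ℕ) :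
    galoisCohomology.localization (κ.twistModPk ρ hM J) (Sum.inr v) 1 ((κ.shiftH1Pk ρ hM J)^[a] x) ∈
      DiscreteGaloisModule.unramifiedSubgroup (GaloisRep.toLocal v (κ.twistModPk ρ hM J)) 1 := by
  induction a with
  | zero => exact hx
  | succ a ih =>
    rw [Function.iterate_succ_apply']
    exact localization_map_mem_unramifiedSubgroup (κ.twistModPkShift ρ hM J) v ih

omit [Finite M] in
/-- **`loc_v (T^a x) = T_v^a (loc_v x)`** for the shift on `H¹(K, 𝒯_J^{(k)})` and its local counterpart.
[cite: SerreGaloisCohomology1997, I §2.4] -/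
theorem localization_iterate_shiftH1Pk (v : HeightOneSpectrum (𝓞 K))
    (x : galoisCohomology (κ.twistModPk ρ hM J) 1) (a : ℕ) :
    galoisCohomology.localization (κ.twistModPk ρ hM J) (Sum.inr v) 1 ((κ.shiftH1Pk ρ hM J)^[a] x) =
      (galoisCohomology.map ((κ.twistModPkShift ρ hM J).restrictField (v.adicCompletion K)) 1)^[a]
        (galoisCohomology.localization (κ.twistModPk ρ hM J) (Sum.inr v) 1 x) :=
  localization_iterate_map (κ.twistModPkShift ρ hM J) (Sum.inr v) x a

section Pairing

variable {e : M →+ M' →+ MuCarrier K (p ^ k)}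
  (he : ∀ (g : absoluteGaloisGroup K) (m : M) (m' : M'), e (ρ g m) (ρ' g m') = mu K (p ^ k) g (e m m'))
include he

variable [LocallyCompactSpace (absoluteGaloisGroup K)] in
omit [Finite M] in
/-- **`loc_v(x ∪ y) = loc_v x ∪ loc_v y`** for T6d's `twistContPairingPk` and its restriction to `Γ_{K_v}`.
[cite: NeukirchSchmidtWingberg2008, I §4 (1.4.2)] -/
theorem localization_cupProduct_twistContPairingPk (v : Place K)
    [LocallyCompactSpace (absoluteGaloisGroup (Place.Completion v))]
    (x : galoisCohomology (κ.twistModPk ρ hM J) 1) (y : galoisCohomology (κ.invTwist.twistModPk ρ' hM' J) 1) :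
    galoisCohomology.localization (mu K (p ^ k)) v 2
        ((κ.twistContPairingPk ρ ρ' (mu K (p ^ k)) hM hM' J he).cupProduct x y) =
      ((κ.twistContPairingPk ρ ρ' (mu K (p ^ k)) hM hM' J he).restrict
          (absGaloisRestrict K (Place.Completion v))).cupProduct
        (galoisCohomology.localization (κ.twistModPk ρ hM J) v 1 x)
        (galoisCohomology.localization (κ.invTwist.twistModPk ρ' hM' J) v 1 y) :=
  ContPairing.cupProduct_res (κ.twistContPairingPk ρ ρ' (mu K (p ^ k)) hM hM' J he)
    (absGaloisRestrict K (Place.Completion v)) x y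

/-! ### §2 STEP 4 on the level-`p^k` twists -/

/-- **STEP 4 on the level-`p^k` twists, `S` a set.**  `p` odd, `k ≥ 1`; `inv : LocalInvariants K (p^k)` with the
Poitou–Tate vanishing; every finite `v ∉ S`, `v ≠ q` has `v ∤ p` and `ρ` unramified; `x ∈ H¹(K, 𝒯_J^{(k)}(ρ, κ))`,
`y ∈ H¹(K, 𝒯_J^{(k)}(ρ′, κ⁻¹))` unramified off `S ∪ {q}`; `loc_v y = 0` on `S` ⟹ the local term at `q` of
`(x, (twistDualMapPk)_* y)` vanishes. [cite: MilneADT2006, Ch. I, Thm. 4.10(b)] -/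
theorem localTerm_twistDualMapPk_eq_zero_of_unramified_outside_set (hp : p ≠ 2) (hk : 1 ≤ k)
    {inv : LocalInvariants K (p ^ k)} (hPT : inv.SumLocalTermEqZero)
    (S : Set (HeightOneSpectrum (𝓞 K))) (q : HeightOneSpectrum (𝓞 K))
    (hSp : ∀ v ∉ S, v ≠ q → ((p : ℕ) : 𝓞 K) ∉ v.asIdeal)
    (hur : ∀ v ∉ S, v ≠ q → GaloisRep.IsUnramifiedAt v ρ)
    (x : galoisCohomology (κ.twistModPk ρ hM J) 1)
    (y : galoisCohomology (κ.invTwist.twistModPk ρ' hM' J) 1)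
    (hx : ∀ v ∉ S, v ≠ q → galoisCohomology.localization (κ.twistModPk ρ hM J) (Sum.inr v) 1 x ∈
      DiscreteGaloisModule.unramifiedSubgroup (GaloisRep.toLocal v (κ.twistModPk ρ hM J)) 1)
    (hy : ∀ v ∉ S, v ≠ q →
      galoisCohomology.localization (κ.invTwist.twistModPk ρ' hM' J) (Sum.inr v) 1 y ∈
        DiscreteGaloisModule.unramifiedSubgroup (GaloisRep.toLocal v (κ.invTwist.twistModPk ρ' hM' J)) 1)
    (hS : ∀ v ∈ S, galoisCohomology.localization (κ.invTwist.twistModPk ρ' hM' J) (Sum.inr v) 1 y = 0) :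
    inv.localTerm (κ.twistModPk ρ hM J) (Sum.inr q) x
      (galoisCohomology.map (κ.twistDualMapPk ρ ρ' (p ^ k) hM hM' J he) 1 y) = 0 := by
  haveI : NeZero (p ^ k) := ⟨pow_ne_zero _ (Fact.out : p.Prime).ne_zero⟩
  have _ := hk
  exact localTerm_pairingDual_eq_zero_of_unramified_outside_set
    (κ.gorensteinPairing_twistModPk_smul ρ ρ' (mu K (p ^ k)) hM hM' J he)
    (((Fact.out : p.Prime).odd_of_ne_two hp).pow) hPT (pow_nsmul_twistPk_eq_zero hM J) S q x y
    (fun v hvS hvq _ ht z =>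
      toLocal_twistModPk_apply_of_mem_absInertia κ ρ hM J v (hur v hvS hvq) (hSp v hvS hvq) ht z)
    (fun v hvS hvq _ ht f =>
      toLocal_tateDual_twistModPk_apply_of_mem_absInertia κ ρ hM J v (hur v hvS hvq) (hSp v hvS hvq) ht f)
    hx hy hS

/-- **STEP 4 on the level-`p^k` twists in the hypothesis shape of the stub** (`q ∉ S`, the Selmer-side class
`Ψ` unramified off `S`, `loc_v (T^[ε] Ψ) = 0` on `S`, the Kolyvagin class unramified off `S ∪ {q}`): for EVERY `a`
the local term at `q` of `(T^a x, (twistDualMapPk)_* (T^ε Ψ))` vanishes. [cite: MilneADT2006, Ch. I, Thm. 4.10(b)] -/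
theorem localTerm_iterate_shiftH1Pk_eq_zero_of_stub_hypotheses (hp : p ≠ 2) (hk : 1 ≤ k)
    {inv : LocalInvariants K (p ^ k)} (hPT : inv.SumLocalTermEqZero)
    (S : Set (HeightOneSpectrum (𝓞 K))) (q : HeightOneSpectrum (𝓞 K)) (hq : q ∉ S)
    (hSp : ∀ v ∉ S, ((p : ℕ) : 𝓞 K) ∉ v.asIdeal)
    (hur : ∀ v ∉ S, GaloisRep.IsUnramifiedAt v ρ)
    (x : galoisCohomology (κ.twistModPk ρ hM J) 1)
    (hx : ∀ v ∉ S, v ≠ q → galoisCohomology.localization (κ.twistModPk ρ hM J) (Sum.inr v) 1 x ∈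
      DiscreteGaloisModule.unramifiedSubgroup (GaloisRep.toLocal v (κ.twistModPk ρ hM J)) 1)
    (Ψ : galoisCohomology (κ.invTwist.twistModPk ρ' hM' J) 1)
    (hΨ : ∀ v ∉ S, galoisCohomology.localization (κ.invTwist.twistModPk ρ' hM' J) (Sum.inr v) 1 Ψ ∈
      DiscreteGaloisModule.unramifiedSubgroup (GaloisRep.toLocal v (κ.invTwist.twistModPk ρ' hM' J)) 1)
    (ε : ℕ)
    (hΨS : ∀ v ∈ S, galoisCohomology.localization (κ.invTwist.twistModPk ρ' hM' J) (Sum.inr v) 1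
      ((κ.invTwist.shiftH1Pk ρ' hM' J)^[ε] Ψ) = 0)
    (a : ℕ) :
    inv.localTerm (κ.twistModPk ρ hM J) (Sum.inr q) ((κ.shiftH1Pk ρ hM J)^[a] x)
      (galoisCohomology.map (κ.twistDualMapPk ρ ρ' (p ^ k) hM hM' J he) 1
        ((κ.invTwist.shiftH1Pk ρ' hM' J)^[ε] Ψ)) = 0 := by
  have _ := hq
  exact localTerm_twistDualMapPk_eq_zero_of_unramified_outside_set κ ρ ρ' hM hM' J he hp hk hPT S q
    (fun v hvS _ => hSp v hvS) (fun v hvS _ => hur v hvS) _ _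
    (fun v hvS hvq => iterate_shiftH1Pk_localization_mem_unramifiedSubgroup κ ρ hM J v (hx v hvS hvq) a)
    (fun v hvS _ => iterate_shiftH1Pk_localization_mem_unramifiedSubgroup κ.invTwist ρ' hM' J v (hΨ v hvS) ε)
    hΨS

variable [LocallyCompactSpace (absoluteGaloisGroup K)]

/-- **STEP 4 at level `p^k`, read on LOCAL classes at `q`**: `inv_q(T_q^a (loc_q x) ∪ loc_q (T^ε Ψ)) = 0` for every
`a`, the cup product being that of T6d's `twistContPairingPk` restricted to `Γ_{K_q}`.
[cite: MilneADT2006, Ch. I, Thm. 4.10(b)] -/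
theorem inv_cupProduct_restrict_iterate_localShift_eq_zero_of_stub_hypothesesPk (hp : p ≠ 2) (hk : 1 ≤ k)
    {inv : LocalInvariants K (p ^ k)} (hPT : inv.SumLocalTermEqZero)
    (S : Set (HeightOneSpectrum (𝓞 K))) (q : HeightOneSpectrum (𝓞 K)) (hq : q ∉ S)
    [LocallyCompactSpace (absoluteGaloisGroup (Place.Completion (Sum.inr q : Place K)))]
    (hSp : ∀ v ∉ S, ((p : ℕ) : 𝓞 K) ∉ v.asIdeal)
    (hur : ∀ v ∉ S, GaloisRep.IsUnramifiedAt v ρ)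
    (x : galoisCohomology (κ.twistModPk ρ hM J) 1)
    (hx : ∀ v ∉ S, v ≠ q → galoisCohomology.localization (κ.twistModPk ρ hM J) (Sum.inr v) 1 x ∈
      DiscreteGaloisModule.unramifiedSubgroup (GaloisRep.toLocal v (κ.twistModPk ρ hM J)) 1)
    (Ψ : galoisCohomology (κ.invTwist.twistModPk ρ' hM' J) 1)
    (hΨ : ∀ v ∉ S, galoisCohomology.localization (κ.invTwist.twistModPk ρ' hM' J) (Sum.inr v) 1 Ψ ∈
      DiscreteGaloisModule.unramifiedSubgroup (GaloisRep.toLocal v (κ.invTwist.twistModPk ρ' hM' J)) 1)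
    (ε : ℕ)
    (hΨS : ∀ v ∈ S, galoisCohomology.localization (κ.invTwist.twistModPk ρ' hM' J) (Sum.inr v) 1
      ((κ.invTwist.shiftH1Pk ρ' hM' J)^[ε] Ψ) = 0)
    (a : ℕ) :
    inv (Sum.inr q)
      (((κ.twistContPairingPk ρ ρ' (mu K (p ^ k)) hM hM' J he).restrict
          (absGaloisRestrict K (Place.Completion (Sum.inr q : Place K)))).cupProduct
        ((galoisCohomology.map ((κ.twistModPkShift ρ hM J).restrictField (q.adicCompletion K)) 1)^[a]
          (galoisCohomology.localization (κ.twistModPk ρ hM J) (Sum.inr q) 1 x))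
        (galoisCohomology.localization (κ.invTwist.twistModPk ρ' hM' J) (Sum.inr q) 1
          ((κ.invTwist.shiftH1Pk ρ' hM' J)^[ε] Ψ))) = 0 := by
  rw [← localization_iterate_shiftH1Pk, ← localization_cupProduct_twistContPairingPk]
  have h := localTerm_iterate_shiftH1Pk_eq_zero_of_stub_hypotheses κ ρ ρ' hM hM' J he hp hk hPT S q hq hSp
    hur x hx Ψ hΨ ε hΨS a
  rw [show κ.twistDualMapPk ρ ρ' (p ^ k) hM hM' J he = pairingDualIntertwining
      (κ.gorensteinPairing_twistModPk_smul ρ ρ' (mu K (p ^ k)) hM hM' J he) from rfl,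
    DiscreteGaloisModule.localTerm_pairingDual] at h
  exact h

/-! ### §3 The G3/G4 meeting point at level `p^k` -/

/-- **STEP 4 + the level-`p^k` `q`-term identity ⟹ `C_i(c(res τ_q), Ψc(res Fr_q)) = 0` for every `i + ε < J`**
(level-`p^k` twin of x10's `convCoeff_eq_zero_of_qTermIdentity`): `hQ` is the `q`-term identity instantiated at the
local classes `loc_q [c]`, `loc_q (T^ε [Ψc])` (cup product of T6d's `twistContPairingPk` restricted to `Γ_{K_q}`),
with `u 0` a unit of the commutative ring `R` and `ι′ : μ_{p^k} ↪ R`; every left side vanishes by §2, and the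
triangular packaging `convCoeff_eq_zero_of_family_eq_zero` concludes.
[cite: MazurRubin2004, Prop. 1.3.2 and §4.4] [cite: MilneADT2006, Ch. I, Thm. 4.10(b)] -/
theorem convCoeff_eq_zero_of_qTermIdentityPk (hp : p ≠ 2) (hk : 1 ≤ k) {inv : LocalInvariants K (p ^ k)}
    (hPT : inv.SumLocalTermEqZero) (S : Set (HeightOneSpectrum (𝓞 K))) (q : HeightOneSpectrum (𝓞 K))
    (hq : q ∉ S) [LocallyCompactSpace (absoluteGaloisGroup (Place.Completion (Sum.inr q : Place K)))]
    (hSp : ∀ v ∉ S, ((p : ℕ) : 𝓞 K) ∉ v.asIdeal) (hur : ∀ v ∉ S, GaloisRep.IsUnramifiedAt v ρ)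
    (c : contOneCocycles (κ.twistModPk ρ hM J).toTopRep)
    (hx : ∀ v ∉ S, v ≠ q → galoisCohomology.localization (κ.twistModPk ρ hM J) (Sum.inr v) 1
        (oneCocycleClass (κ.twistModPk ρ hM J).toTopRep c) ∈
      DiscreteGaloisModule.unramifiedSubgroup (GaloisRep.toLocal v (κ.twistModPk ρ hM J)) 1)
    (Ψc : contOneCocycles (κ.invTwist.twistModPk ρ' hM' J).toTopRep)
    (hΨ : ∀ v ∉ S, galoisCohomology.localization (κ.invTwist.twistModPk ρ' hM' J) (Sum.inr v) 1
        (oneCocycleClass (κ.invTwist.twistModPk ρ' hM' J).toTopRep Ψc) ∈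
      DiscreteGaloisModule.unramifiedSubgroup (GaloisRep.toLocal v (κ.invTwist.twistModPk ρ' hM' J)) 1)
    (ε : ℕ)
    (hΨS : ∀ v ∈ S, galoisCohomology.localization (κ.invTwist.twistModPk ρ' hM' J) (Sum.inr v) 1
      ((κ.invTwist.shiftH1Pk ρ' hM' J)^[ε] (oneCocycleClass (κ.invTwist.twistModPk ρ' hM' J).toTopRep Ψc)) = 0)
    (τq Frq : absoluteGaloisGroup (q.adicCompletion K))
    {R : Type*} [CommRing R] (ι : ZMod (p ^ k) →+ R) (ι' : MuCarrier K (p ^ k) →+ R)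
    (hι' : Function.Injective ι') (u : ℕ → R) (hu : IsUnit (u 0))
    (hQ : ∀ j < J, ι (inv (Sum.inr q)
        (((κ.twistContPairingPk ρ ρ' (mu K (p ^ k)) hM hM' J he).restrict
            (absGaloisRestrict K (Place.Completion (Sum.inr q : Place K)))).cupProduct
          ((galoisCohomology.map ((κ.twistModPkShift ρ hM J).restrictField (q.adicCompletion K)) 1)^[J - 1 - j]
            (galoisCohomology.localization (κ.twistModPk ρ hM J) (Sum.inr q) 1
              (oneCocycleClass (κ.twistModPk ρ hM J).toTopRep c)))
          (galoisCohomology.localization (κ.invTwist.twistModPk ρ' hM' J) (Sum.inr q) 1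
            ((κ.invTwist.shiftH1Pk ρ' hM' J)^[ε]
              (oneCocycleClass (κ.invTwist.twistModPk ρ' hM' J).toTopRep Ψc))))) =
      ∑ j' ∈ range (j + 1), u j' * ι' (convCoeff e J (j - j')
        (c.1 (absGaloisRestrict K (q.adicCompletion K) τq))
        ((shiftEnd M' J ^ ε) (Ψc.1 (absGaloisRestrict K (q.adicCompletion K) Frq))))) :
    ∀ i, i + ε < J → convCoeff e J i (c.1 (absGaloisRestrict K (q.adicCompletion K) τq))
      (Ψc.1 (absGaloisRestrict K (q.adicCompletion K) Frq)) = 0 := by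
  refine convCoeff_eq_zero_of_family_eq_zero e ι' hι' hu ε _ _ fun j hj => ?_
  rw [← hQ j hj, inv_cupProduct_restrict_iterate_localShift_eq_zero_of_stub_hypothesesPk κ ρ ρ' hM hM' J he hp hk
    hPT S q hq hSp hur _ hx _ hΨ ε hΨS (J - 1 - j), map_zero]

end Pairing

end Summit.BirchSwinnertonDyer.BirchSwinnertonDyer.Theorems.OneSidedTwistSqueezeX9KatoDivisibilityX9KolyvaginReciprocityPkStepFour

end
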